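import Literature.MathematicalPhysics.KineticTheory.InfiniteChainSpecificationLocality
import Literature.MathematicalPhysics.KineticTheory.InfiniteChainGibbsNormalisable
import Literature.Probability.LatticeModels.GibbsSpecificationTilted
import Literature.Probability.LatticeModels.GibbsSpecificationCofinal

/-!
# `EmbeddedDrudeMourre.MourreDissolution`, line `separable-vertex-faddeev-pair-sector` —
# first brick of the Gibbs-state stub (H): DLR consistency of the chain's finite-volume kernels

Item `stmt-AtomisticToContinuum-12594` (crux `MourreDissolution` of route `EmbeddedDrudeMourre`,
sub-problem `FouriersLaw`). The infrastructure hypothesis (H) of `stub_symmetricFramework` (see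
`…FrameworkReduction`) begins with the EXISTENCE of a DLR Gibbs state
(`OscillatorChain.IsChainGibbsMeasure`) of the pinned anharmonic chain. Its finite-volume kernels
`γ_Λ(· | η) = OscillatorChain.chainSpecification P T Λ η` (Lanford–Lebowitz–Lieb 1977 (14); built
with `Literature.Probability.LatticeModels.gibbsSpecOfPotential` from the a priori measure Lebesgue
on `ℝ × ℝ` — NOT finite — and the UNBOUNDED potential `½p² + U(q)`, `V(q_{x+1} - q_x)`) are outside
the scope of the tree's `isSpecification_gibbsSpecOfPotential` (finite a priori measure, bounded
potential). This file proves Georgii's specification axioms for them under the chain's honest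
hypotheses — `U`, `V` measurable and LLL's normalisability condition B2 (`OscillatorChain.CondB2`,
a THEOREM for confining chains: `OscillatorChain.condB2_of_integrable_exp_neg`):

* `lmarginal_boltzmann_ne_top_of_condB2` — under B2 every normaliser
  `Z_Λ(η) = (∫⋯∫⁻_Λ e^{-H_Λ/T})(η)` is finite (a `Measure.tilted` probability measure has an
  integrable density);
* `hamiltonianIn_chain_eq_add_of_subset`, `dependsOn_hamiltonianIn_chain_remainder` — for
  `Λ ⊆ Λ'`, `H_{Λ'} = H_Λ + R` with `R` (the sites of `Λ' \ Λ` and the bonds meeting `Λ'` but not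
  `Λ`) not reading the configuration in `Λ` (Friedli–Velenik (6.10));
* `chainSpecification_consistent` — **consistency** `γ_{Λ'} γ_Λ = γ_{Λ'}` for `Λ ⊆ Λ'`
  (Georgii 2011, Def. 1.23 (iii); the marginal-integral proof of Friedli–Velenik Lemma 6.15, run
  with the tree's fibre identity `lmarginal_mul_mul_eq_of_dependsOn` and the chain's
  ratio-of-marginals formulae `chainSpecification_apply_eq_lmarginal_div`,
  `lintegral_chainSpecification_eq_lmarginal_div`);
* `ae_eq_off_chainSpecification` (properness), `measurable_cylinderEvents_chainSpecification_apply`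
  (`𝓕_{Λᶜ}`-measurability in the boundary condition);
* `isSpecification_chainSpecification` — **`chainSpecification P T` is a specification in
  Georgii's sense** (`Literature.Probability.LatticeModels.IsSpecification`) for measurable `U, V`
  under B2; `isSpecification_chainSpecification_pinnedChain` — the instance for
  `pinnedChain ω₂ lam β γ` (`ω₂ > 0`, `lam, β ≥ 0`) at every `T > 0`;
* `isChainGibbsMeasure_of_forall_Icc` — hence the DLR equations on the intervals `{-n, …, n}`
  already make a probability measure a Gibbs state of the chain (Georgii 2011, Remark 1.24; tree:
  `isGibbsMeasure_of_forall_Icc`), the form in which the transfer-operator Markov chain will be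
  shown to be Gibbs (next brick).
-/

noncomputable section

namespace Summit.AtomisticToContinuum.FouriersLaw.Theorems.MourreDissolution

open MeasureTheory Filter Set Function Literature.Probability.LatticeModels
open Literature.MathematicalPhysics.KineticTheory.HeatConduction
open scoped ENNReal

/-! ## The normaliser under condition B2 -/

/-- **Under LLL's condition B2 every normaliser is finite**: if `γ_Λ(· | η)` is a probability
measure then `Z_Λ(η) = (∫⋯∫⁻_Λ e^{-H_Λ/T})(η) < ∞` — Mathlib's `Measure.tilted` returns the zero
measure when the density `e^{-H_Λ/T}` is not integrable against the a priori measure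
`(dq dp)^{⊗Λ} ⊗ δ_η`, and that integral is the marginal integral
(`OscillatorChain.lintegral_map_glueWith_pi_eq_lmarginal`).
[cite: LanfordLebowitzLieb1977, §4 condition B2] -/
theorem lmarginal_boltzmann_ne_top_of_condB2 {P : OscillatorChain} (hU : Measurable P.U)
    (hV : Measurable P.V) {T : ℝ} (hB2 : P.CondB2 T) (Λ : Finset ℤ) (η : ChainConfig) :
    (∫⋯∫⁻_Λ, (fun σ : ChainConfig =>
        ENNReal.ofReal (Real.exp (-T⁻¹ * hamiltonianIn P.chainPotential OscillatorChain.chainSupp Λ σ)))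
      ∂fun _ : ℤ => (volume : Measure (ℝ × ℝ))) η ≠ ∞ := by
  set m : Measure ChainConfig :=
    (Measure.pi fun _ : Λ => (volume : Measure (ℝ × ℝ))).map (glueWith Λ · η) with hm
  set f : ChainConfig → ℝ := fun σ => -T⁻¹ * hamiltonianIn P.chainPotential OscillatorChain.chainSupp Λ σ with hf
  have hprob : IsProbabilityMeasure (m.tilted f) := hB2 Λ η
  have hint : Integrable (fun σ => Real.exp (f σ)) m := by
    by_contra h
    exact IsProbabilityMeasure.ne_zero (m.tilted f) (tilted_of_not_integrable h)
  rw [← OscillatorChain.lintegral_map_glueWith_pi_eq_lmarginal Λ η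
    (P.measurable_boltzmannWeight hU hV T Λ)]
  exact ((hasFiniteIntegral_iff_ofReal (Eventually.of_forall fun σ => (Real.exp_pos _).le)).1
    hint.hasFiniteIntegral).ne

/-! ## Locality of the energy difference `H_{Λ'} - H_Λ` -/

/-- The bond sets are monotone: `Λ ⊆ Λ'` implies `Λ ∪ (Λ - 1) ⊆ Λ' ∪ (Λ' - 1)`. [folklore] -/
theorem bondSet_mono {Λ Λ' : Finset ℤ} (h : Λ ⊆ Λ') :
    OscillatorChain.bondSet Λ ⊆ OscillatorChain.bondSet Λ' :=
  Finset.union_subset_union h (Finset.image_subset_image h)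

/-- **Additivity of the finite-volume Hamiltonians of the chain**: for `Λ ⊆ Λ'`,
`H_{Λ'} = H_Λ + (∑_{x ∈ Λ' \ Λ} (½p_x² + U(q_x)) + ∑_{y ∈ bondSet Λ' \ bondSet Λ} V(q_{y+1} - q_y))`
(LLL (10): the sites of `Λ' \ Λ` and the bonds meeting `Λ'` but not `Λ`).
[cite: LanfordLebowitzLieb1977, §2 eq. (10)] -/
theorem hamiltonianIn_chain_eq_add_of_subset (P : OscillatorChain) {Λ Λ' : Finset ℤ} (h : Λ ⊆ Λ')
    (σ : ChainConfig) :
    hamiltonianIn P.chainPotential OscillatorChain.chainSupp Λ' σ = hamiltonianIn P.chainPotential OscillatorChain.chainSupp Λ σ +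
      (∑ x ∈ Λ' \ Λ, ((σ x).2 ^ 2 / 2 + P.U (σ x).1) +
        ∑ y ∈ OscillatorChain.bondSet Λ' \ OscillatorChain.bondSet Λ,
          P.V ((σ (y + 1)).1 - (σ y).1)) := by
  rw [P.hamiltonianIn_chain, P.hamiltonianIn_chain, ← Finset.sum_sdiff h,
    ← Finset.sum_sdiff (bondSet_mono h)]
  ring

/-- **The energy difference `H_{Λ'} - H_Λ` does not read the configuration in `Λ`**
(Friedli–Velenik 2017, (6.10): `H_Λ - H_Δ` is `𝓕_{Δᶜ}`-measurable): a bond `{y, y+1}` not meeting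
`Λ` has both endpoints off `Λ`. [cite: FriedliVelenik2017, Lemma 6.15] -/
theorem dependsOn_hamiltonianIn_chain_remainder (P : OscillatorChain) {Λ Λ' : Finset ℤ} :
    DependsOn (fun σ : ChainConfig => ∑ x ∈ Λ' \ Λ, ((σ x).2 ^ 2 / 2 + P.U (σ x).1) +
        ∑ y ∈ OscillatorChain.bondSet Λ' \ OscillatorChain.bondSet Λ, P.V ((σ (y + 1)).1 - (σ y).1))
      ((↑Λ : Set ℤ)ᶜ) := by
  intro σ σ' hσ
  have hσ' : ∀ i : ℤ, i ∉ Λ → σ i = σ' i := fun i hi => hσ i (by simpa using hi)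
  simp only
  congr 1
  · refine Finset.sum_congr rfl fun x hx => ?_
    rw [hσ' x (Finset.mem_sdiff.1 hx).2]
  · refine Finset.sum_congr rfl fun y hy => ?_
    have hy' : y ∉ OscillatorChain.bondSet Λ := (Finset.mem_sdiff.1 hy).2
    have h1 : y ∉ Λ := fun hh => hy' (OscillatorChain.subset_bondSet Λ hh)
    have h2 : y + 1 ∉ Λ := fun hh => hy' (OscillatorChain.image_sub_one_subset_bondSet Λ
      (Finset.mem_image.2 ⟨y + 1, hh, by ring⟩))
    rw [hσ' y h1, hσ' (y + 1) h2]

/-! ## Consistency -/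

/-- **DLR consistency of the chain's finite-volume Gibbs distributions**: for measurable `U, V`,
under condition B2, and `Λ ⊆ Λ'`,
`∫ γ_Λ(A | σ) γ_{Λ'}(dσ | η) = γ_{Λ'}(A | η)` (Georgii 2011, Def. 1.23 (iii); Friedli–Velenik 2017,
Lemma 6.15, whose proof "extends immediately" to a reference measure, §6.10.1). Proof: both sides
are ratios of `Λ'`-marginal integrals with the same (finite, positive) normaliser `Z_{Λ'}(η)`; by
Tonelli (`lmarginal_eq_of_subset`) it suffices to compare the `Λ`-marginals of the numerators,
which agree by the fibre identity `lmarginal_mul_mul_eq_of_dependsOn`: `e^{-H_{Λ'}/T} = e^{-H_Λ/T} u`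
with `u = e^{-(H_{Λ'} - H_Λ)/T}` and `γ_Λ(A | ·)` constant along `Λ`-fibres, and
`Z_Λ · γ_Λ(A | ·) = ∫⋯∫⁻_Λ e^{-H_Λ/T} 𝟙_A` (`0 < Z_Λ < ∞`). [cite: Georgii2011, Def. 1.23] -/
theorem chainSpecification_consistent {P : OscillatorChain} (hU : Measurable P.U) (hV : Measurable P.V)
    {T : ℝ} (hB2 : P.CondB2 T) {Λ Λ' : Finset ℤ} (hsub : Λ ⊆ Λ') (η : ChainConfig)
    {A : Set ChainConfig} (hA : MeasurableSet A) :
    ∫⁻ σ, P.chainSpecification T Λ σ A ∂(P.chainSpecification T Λ' η) =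
      P.chainSpecification T Λ' η A := by
  -- measurability, finiteness and positivity of the ingredients
  have hw : ∀ Δ : Finset ℤ, Measurable fun σ : ChainConfig =>
      ENNReal.ofReal (Real.exp (-T⁻¹ * hamiltonianIn P.chainPotential OscillatorChain.chainSupp Δ σ)) :=
    fun Δ => P.measurable_boltzmannWeight hU hV T Δ
  have hind : Measurable (A.indicator (1 : ChainConfig → ℝ≥0∞)) := measurable_one.indicator hA
  have hqm : Measurable fun σ => P.chainSpecification T Λ σ A :=
    P.measurable_chainSpecification_apply hU hV T Λ hA
  have hZtop := lmarginal_boltzmann_ne_top_of_condB2 hU hV hB2 Λ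
  have hZ0 : ∀ ρ : ChainConfig, (∫⋯∫⁻_Λ, (fun σ : ChainConfig =>
      ENNReal.ofReal (Real.exp (-T⁻¹ * hamiltonianIn P.chainPotential OscillatorChain.chainSupp Λ σ)))
        ∂fun _ : ℤ => (volume : Measure (ℝ × ℝ))) ρ ≠ 0 :=
    fun ρ => (P.lmarginal_boltzmann_pos hU hV T Λ ρ).ne'
  -- both sides as ratios of `Λ'`-marginals with the same normaliser
  rw [P.lintegral_chainSpecification_eq_lmarginal_div hU hV T Λ' η
      (lmarginal_boltzmann_ne_top_of_condB2 hU hV hB2 Λ' η) hqm,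
    P.chainSpecification_apply_eq_lmarginal_div hU hV T Λ' η hA]
  congr 1
  refine congrFun (lmarginal_eq_of_subset (μ := fun _ : ℤ => (volume : Measure (ℝ × ℝ))) hsub
    (hqm.mul (hw Λ')) (hind.mul (hw Λ')) ?_) η
  -- split `e^{-H_{Λ'}/T} = e^{-H_Λ/T} · u`, `u` not reading `Λ`
  have hsplit : ∀ σ : ChainConfig,
      ENNReal.ofReal (Real.exp (-T⁻¹ * hamiltonianIn P.chainPotential OscillatorChain.chainSupp Λ' σ)) =
        ENNReal.ofReal (Real.exp (-T⁻¹ * hamiltonianIn P.chainPotential OscillatorChain.chainSupp Λ σ)) *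
          ENNReal.ofReal (Real.exp (-T⁻¹ *
            (∑ x ∈ Λ' \ Λ, ((σ x).2 ^ 2 / 2 + P.U (σ x).1) +
              ∑ y ∈ OscillatorChain.bondSet Λ' \ OscillatorChain.bondSet Λ,
                P.V ((σ (y + 1)).1 - (σ y).1)))) := fun σ => by
    rw [← ENNReal.ofReal_mul (Real.exp_pos _).le, ← Real.exp_add, ← mul_add,
      ← hamiltonianIn_chain_eq_add_of_subset P hsub σ]
  have e1 : ((fun σ : ChainConfig => P.chainSpecification T Λ σ A) * fun σ : ChainConfig =>
      ENNReal.ofReal (Real.exp (-T⁻¹ * hamiltonianIn P.chainPotential OscillatorChain.chainSupp Λ' σ))) =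
      fun σ => ENNReal.ofReal (Real.exp (-T⁻¹ * hamiltonianIn P.chainPotential OscillatorChain.chainSupp Λ σ)) *
        ENNReal.ofReal (Real.exp (-T⁻¹ *
          (∑ x ∈ Λ' \ Λ, ((σ x).2 ^ 2 / 2 + P.U (σ x).1) +
            ∑ y ∈ OscillatorChain.bondSet Λ' \ OscillatorChain.bondSet Λ,
              P.V ((σ (y + 1)).1 - (σ y).1)))) *
        P.chainSpecification T Λ σ A := by
    funext σ
    rw [Pi.mul_apply, hsplit σ]
    ring
  have e2 : (A.indicator (1 : ChainConfig → ℝ≥0∞) * fun σ : ChainConfig =>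
      ENNReal.ofReal (Real.exp (-T⁻¹ * hamiltonianIn P.chainPotential OscillatorChain.chainSupp Λ' σ))) =
      fun σ => ENNReal.ofReal (Real.exp (-T⁻¹ * hamiltonianIn P.chainPotential OscillatorChain.chainSupp Λ σ)) *
        ENNReal.ofReal (Real.exp (-T⁻¹ *
          (∑ x ∈ Λ' \ Λ, ((σ x).2 ^ 2 / 2 + P.U (σ x).1) +
            ∑ y ∈ OscillatorChain.bondSet Λ' \ OscillatorChain.bondSet Λ,
              P.V ((σ (y + 1)).1 - (σ y).1)))) *
        A.indicator 1 σ := by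
    funext σ
    rw [Pi.mul_apply, hsplit σ]
    ring
  rw [e1, e2]
  refine lmarginal_mul_mul_eq_of_dependsOn (fun _ : ℤ => (volume : Measure (ℝ × ℝ))) Λ (hw Λ) hind
    (fun σ σ' hσ => ?_) (P.dependsOn_chainSpecification_apply hU hV T Λ hA) fun ρ => ?_
  · -- `u` does not read `Λ`
    have hR := dependsOn_hamiltonianIn_chain_remainder P (Λ := Λ) (Λ' := Λ') hσ
    simp only at hR ⊢
    rw [hR]
  · -- `Z_Λ(ρ) · γ_Λ(A | ρ) = (∫⋯∫⁻_Λ e^{-H_Λ/T} 𝟙_A)(ρ)`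
    rw [P.chainSpecification_apply_eq_lmarginal_div hU hV T Λ ρ hA,
      ENNReal.mul_div_cancel (hZ0 ρ) (hZtop ρ)]
    congr 1
    funext τ
    exact mul_comm _ _

/-! ## Properness and measurability in the boundary condition -/

/-- **Properness**: `γ_Λ(· | η)`-almost every configuration agrees with `η` off `Λ` (the a priori
measure is carried by the glued configurations and `Measure.tilted` is absolutely continuous; tree:
`ae_eq_of_not_mem_tilted_map_glueWith_pi`) (Georgii 2011, Def. 1.23 (ii)).
[cite: Georgii2011, Def. 1.23] -/
theorem ae_eq_off_chainSpecification (P : OscillatorChain) (T : ℝ) (Λ : Finset ℤ) (η : ChainConfig) :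
    ∀ᵐ σ ∂(P.chainSpecification T Λ η), ∀ x ∉ Λ, σ x = η x :=
  ae_eq_of_not_mem_tilted_map_glueWith_pi (volume : Measure (ℝ × ℝ)) Λ η _

/-- **`𝓕_{Λᶜ}`-measurability of `η ↦ γ_Λ(A | η)`** for measurable `U, V, A`: a ratio of two
`Λ`-marginal integrals, each measurable for the outside σ-algebra (tree:
`measurable_cylinderEvents_lmarginal`) (Georgii 2011, Def. 1.23 (ii)). [cite: Georgii2011, Def. 1.23] -/
theorem measurable_cylinderEvents_chainSpecification_apply {P : OscillatorChain} (hU : Measurable P.U)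
    (hV : Measurable P.V) (T : ℝ) (Λ : Finset ℤ) {A : Set ChainConfig} (hA : MeasurableSet A) :
    Measurable[cylinderEvents (X := fun _ : ℤ => ℝ × ℝ) ((↑Λ : Set ℤ)ᶜ)]
      fun η : ChainConfig => P.chainSpecification T Λ η A := by
  have hw := P.measurable_boltzmannWeight hU hV T Λ
  have hform : (fun η : ChainConfig => P.chainSpecification T Λ η A) = fun η =>
      (∫⋯∫⁻_Λ, (fun σ : ChainConfig => A.indicator 1 σ *
          ENNReal.ofReal (Real.exp (-T⁻¹ * hamiltonianIn P.chainPotential OscillatorChain.chainSupp Λ σ)))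
        ∂fun _ : ℤ => (volume : Measure (ℝ × ℝ))) η /
      (∫⋯∫⁻_Λ, (fun σ : ChainConfig =>
          ENNReal.ofReal (Real.exp (-T⁻¹ * hamiltonianIn P.chainPotential OscillatorChain.chainSupp Λ σ)))
        ∂fun _ : ℤ => (volume : Measure (ℝ × ℝ))) η :=
    funext fun η => P.chainSpecification_apply_eq_lmarginal_div hU hV T Λ η hA
  rw [hform]
  exact (measurable_cylinderEvents_lmarginal (volume : Measure (ℝ × ℝ)) Λ
    ((measurable_one.indicator hA).mul hw)).div
    (measurable_cylinderEvents_lmarginal (volume : Measure (ℝ × ℝ)) Λ hw)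

/-! ## The chain's kernels form a specification; Gibbs states from the DLR equations on intervals -/

/-- **The finite-volume Gibbs distributions of an oscillator chain form a specification in
Georgii's sense** (probability, `𝓕_{Λᶜ}`-measurability, properness, consistency:
`Literature.Probability.LatticeModels.IsSpecification`) as soon as `U`, `V` are measurable and
LLL's normalisability condition B2 holds (Georgii 2011, Def. 1.23 with Def. 2.9 — Gibbsian
specifications of a `λ`-admissible potential; Lanford–Lebowitz–Lieb 1977, §4: "Condition B2 makes
it possible to define Gibbs states by an obvious adaptation of the definitions").
[cite: Georgii2011, Def. 1.23] -/
theorem isSpecification_chainSpecification : ∀ (P : Literature.MathematicalPhysics.KineticTheory.HeatConduction.OscillatorChain) (T : ℝ), Measurable P.U → Measurable P.V → P.CondB2 T → Literature.Probability.LatticeModels.IsSpecification (P.chainSpecification T) := by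
  intro P T hU hV hB2
  exact
    { isProbability := hB2
      measurable := fun Λ _ hA => measurable_cylinderEvents_chainSpecification_apply hU hV T Λ hA
      proper := fun Λ η => ae_eq_off_chainSpecification P T Λ η
      consistent := fun _ _ h η _ hA => chainSpecification_consistent hU hV hB2 h η hA }

/-- **The kernels of the pinned anharmonic chain `pinnedChain ω₂ lam β γ` (`ω₂ > 0`, `lam, β ≥ 0`)
form a specification at every temperature `T > 0`** (B2 is the tree's
`OscillatorChain.condB2_pinnedChain`; `U`, `V` are polynomials). [cite: Georgii2011, Def. 1.23] -/
theorem isSpecification_chainSpecification_pinnedChain {ω₂ lam β : ℝ} (γ : ℝ) (hω : 0 < ω₂)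
    (hl : 0 ≤ lam) (hβ : 0 ≤ β) {T : ℝ} (hT : 0 < T) :
    IsSpecification ((pinnedChain ω₂ lam β γ).chainSpecification T) := by
  refine isSpecification_chainSpecification _ T ?_ ?_
    (OscillatorChain.condB2_pinnedChain γ hω hl hβ hT)
  · show Measurable fun q : ℝ => ω₂ * q ^ 2 / 2 + lam * q ^ 4 / 4
    fun_prop
  · show Measurable fun r : ℝ => r ^ 2 / 2 + β * r ^ 4 / 4
    fun_prop

/-- **Gibbs states of the chain from the DLR equations on intervals**: for measurable `U, V` under
B2, a probability measure `μ` on `ℤ → ℝ × ℝ` satisfying `∫ γ_{[-n,n]}(A | η) dμ(η) = μ(A)` for all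
`n ∈ ℕ` and measurable `A` is a DLR Gibbs state of the chain at temperature `T` (Georgii 2011,
Remark 1.24: consistency transfers the DLR equation from a volume to its sub-volumes; the intervals
are cofinal; tree: `isGibbsMeasure_of_forall_Icc`). [cite: Georgii2011, Rem. 1.24] -/
theorem isChainGibbsMeasure_of_forall_Icc {P : OscillatorChain} (hU : Measurable P.U)
    (hV : Measurable P.V) {T : ℝ} (hB2 : P.CondB2 T) {μ : Measure ChainConfig}
    [IsProbabilityMeasure μ]
    (hDLR : ∀ (n : ℕ) (A : Set ChainConfig), MeasurableSet A →
      ∫⁻ η, P.chainSpecification T (Finset.Icc (-(n : ℤ)) n) η A ∂μ = μ A) :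
    P.IsChainGibbsMeasure T μ :=
  isGibbsMeasure_of_forall_Icc (fun Λ _ hA => P.measurable_chainSpecification_apply hU hV T Λ hA)
    (fun _ _ h η _ hA => chainSpecification_consistent hU hV hB2 h η hA) hDLR

end Summit.AtomisticToContinuum.FouriersLaw.Theorems.MourreDissolution

end
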